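import Summits.QuantumFields.BalabanUV.Beta.GAN24.SourceBracketChannelCharge
import Summits.QuantumFields.BalabanUV.Beta.GAN24.T2UndressedCombDriftEnd
import Summits.QuantumFields.BalabanUV.Beta.GAN24.T2DevCovariance

/-!
# `BalabanUV.Beta.GAN24.SourceBracketChannelChargeComb` — binder row G-an2-4 ∕ (CONV-C), W-slot CT-W, route «WC-TL», rows (U) ∕ (U-drift):
# **F2a-comb FROM THE CELL CHANNEL IDENTITIES, AND THE (U) ∕ (U-drift) ENDs RE-READ ON THEM** (`d = 3`, the consumers' literal)

NOT IN PRINT; OUR BOOKKEEPING ([folklore] composition BY NAME, zero new content: PART 1 `SourceBracketChannelCharge.zmodeSym_comb_bracket_eq_zero_of_cell` (the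
symmetrised cell charge from ONE scalar cell identity) + leaf-01 g63's `T2DevCovariance.source_comb_undressed_translate` (the comb source's joint `Lc`-covariance) ⇒ the
`hZ` binder («F2a-comb») of this lineage's (B) `T2UndressedCombShapeEnd.t2Shape_undressedComb_three_of_F2a` ∕ PART 3 `T2UndressedCombDriftEnd.exists_hU_three_of_F2a_pinEq`
TOKEN FOR TOKEN; G-an2-4 formalisation swarm, leaf prover `b2b-balaban-gan24-formalise-leaf-04`, gen 60; names PROVISIONAL).  HONEST FRAMING (cell contract, verbatim):
«discharging `BetaPertH` makes Bałaban's UV stability UNCONDITIONAL — a real constructive-QFT result; it is NOT the continuum limit and NOT the Clay problem.»  HONEST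
DEPENDENCY (verbatim): «continuum YM on T⁴ ⇐ BetaPertH ∧ nine spine estimates (0/9 proved); BetaPertH ⇐ (D1) ∧ (D4) ∧ CAP+tail; G-an2-4 gates asym, D1 and NE2/3/4.»

WHAT (`d = 3`, `2 ≤ Lc`, every in-block root `r`, every `cE cVH cΛ cE₂ cB Tc`, every jointly `Lc`-covariant off-diagonal `LocStencil₂` border `vh₂S`):
* §1 **`hZ_comb_of_cells`** — F2a-comb (BOTH conjuncts, every level `i`: joint `Lc`-covariance ∧ symmetrised `Lc`-cell ff charge zero of the undressed-kernel comb source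
  `b^B_i`) ⟸ the border's covariance `hBt` ∧ the four channel bond-series VALUES `e₁ e₂ r₁ r₂` (level-indexed) ∧ **ONE scalar symmetrised CELL identity per `(i, α, β, κ, κ′)`**
  (`hcell`).  The covariance conjunct is leaf-01's `source_comb_undressed_translate`; the charge conjunct is PART 1's §4 at `c := cE₂·Lc^{2(d+1)}`.
* §2 **`t2Shape_undressedComb_three_of_cells`** (ROW (U)) and **`exists_hU_three_of_cells_pinEq`** (ROW (U-drift), the OWNER's `hU` quintuple, exact pin `cE₂ = Lc⁸`):
  this lineage's (B) ∕ PART 3 with `hZ := §1` — «T2Shape» ∕ «T2Drift» OF THE REFERENCE TOWER MODULO THE CELL CHANNEL IDENTITIES (instead of modulo F2a-comb).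
THE CELL IDENTITY IS A HYPOTHESIS (its supplier — a cell-level Ward cancellation for `SpureRecAt` ∕ `M1At` — is UNLOCATED; road W3's Stage-B plug proves the four channels
vanish POINTWISE for `Spure` ∕ `M1`, which is MORE than `hcell` asks); asserts NO value of Bałaban's tables; discharges NOTHING of (U) ∕ (U-drift) unconditionally, nor (C),
«T2Shape»(E), «T2Drift»(E), (hW, hWall); NEVER «G-an2-4 closed» as (CONV-C); NOT D1, NOT `BetaPertH`, NOT continuum, NOT Clay.  0 `def`, 0 cited facts, 0 `def … : Prop`,
0 sorry.  2026-08-22.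
-/

noncomputable section

open Finset
open scoped BigOperators
open Literature.MathematicalPhysics.QuantumFieldTheory
open Literature.MathematicalPhysics.QuantumFieldTheory.Balaban1983to89
open Literature.MathematicalPhysics.QuantumFieldTheory.Balaban1983to89.Beta
open AffineAveraging (Site box toSite)
open ExpKernelCalculus (MKer Decays comp shiftK)
open OneStepResolventKernel (Fib LocStencil)
open OneStepKernelFamily (KInvStep)
open SecondOrderResponse (dM K2OfK W2SymOfK)
open AveragingMixedJetTables (mixFFAt)
open BalabanCompositeJets (LocStencil₂)
open BalabanStepW2 (K3OfK M2Of)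
open BalabanStepJetsSucc (mmRead)
open Summit.QuantumFields.BalabanUV.Beta.HessKerDressedUnits (unitK unitS)
open Summit.QuantumFields.BalabanUV.Beta.SecondOrderUnits (unitM unitS₂ unitM₂)
open Summit.QuantumFields.BalabanUV.Beta.SpineRooted (T2RecOf SpureRecAt M1At)
open Summit.QuantumFields.BalabanUV.Beta.GAN24.CombesThomas (sfStep smStep)
open Summit.QuantumFields.BalabanUV.Beta.GAN24.BiStencilZeroMode (Tab zmode)
open Summit.QuantumFields.BalabanUV.Beta.GAN24.SourceBracketChannelCharge (zmodeSym_comb_bracket_eq_zero_of_cell)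
open Summit.QuantumFields.BalabanUV.Beta.GAN24.T2DevCovariance (source_comb_undressed_translate)
open Summit.QuantumFields.BalabanUV.Beta.GAN24.T2UndressedCombShapeEnd (t2Shape_undressedComb_three_of_F2a)
open Summit.QuantumFields.BalabanUV.Beta.GAN24.T2UndressedCombDriftEnd (exists_hU_three_of_F2a_pinEq)

namespace Summit.QuantumFields.BalabanUV.Beta.GAN24.SourceBracketChannelChargeComb

variable {Lc : ℕ} [NeZero Lc] {r : Fin (3 + 1) → ℕ}

/-! ## §1 F2a-comb from the cell channel identities -/

/-- NOT IN PRINT; OUR BOOKKEEPING ([folklore]; leaf-01's `source_comb_undressed_translate` for the covariance conjunct, PART 1's `zmodeSym_comb_bracket_eq_zero_of_cell`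
at `c := cE₂·Lc^{2(d+1)}` for the charge conjunct).  **F2a-comb FROM THE CELL CHANNEL IDENTITIES** (`d = 3`): for `2 ≤ Lc`, an in-block root `r`, every `cE cVH cΛ cE₂ cB Tc`,
a jointly `Lc`-covariant off-diagonal `LocStencil₂` border: if the four channel bond series of the recursive tables at every level `i` have sums `e₁ e₂ r₁ r₂ i α β κ u κ′` and
the symmetrised cell identity `hcell` holds at every `(i, α, β, κ, κ′)`, then the `hZ` binder («F2a-comb») of `t2Shape_undressedComb_three_of_F2a` ∕
`exists_hU_three_of_F2a_pinEq` holds TOKEN FOR TOKEN.  `hcell` is the HYPOTHESIS; nothing of it is proved here. -/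
theorem hZ_comb_of_cells (hLc : 2 ≤ Lc) (hr : r ∈ box (3 + 1) Lc) (cE cVH cΛ cE₂ cB : ℝ)
    (Tc : Fin 4 → Fin 4 → Fin 4 → Fin 4 → ℝ) {vh₂S : Tab 3}
    (hBff : ∀ κ u κ' u' x z (α β : Fin (3 + 1)), vh₂S κ u κ' u' x z (Sum.inl α) (Sum.inl β) = 0)
    (hBmm : ∀ κ u κ' u' x z (μ ν : Fin (3 + 1)), vh₂S κ u κ' u' x z (Sum.inr μ) (Sum.inr ν) = 0)
    {CB δB : ℝ} (hB : LocStencil₂ vh₂S CB δB) (hδB : 0 < δB)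
    (hBt : ∀ (κ : Fin (3 + 1)) (u : Fin (3 + 1) → ℤ) (κ' : Fin (3 + 1)) (u' t : Fin (3 + 1) → ℤ),
      vh₂S κ (u + (Lc : ℤ) • t) κ' (u' + (Lc : ℤ) • t) = shiftK (-((Lc : ℤ) • t)) (vh₂S κ u κ' u'))
    {e₁ e₂ r₁ r₂ : ℕ → Fin (3 + 1) → Fin (3 + 1) → Fin (3 + 1) → Site (3 + 1) → Fin (3 + 1) → ℝ}
    (hE₁ : ∀ (i : ℕ) (α β κ : Fin (3 + 1)) (u : Site (3 + 1)) (κ' : Fin (3 + 1)), HasSum (fun u' : Site (3 + 1) => ∑' yw : Site (3 + 1) × Site (3 + 1),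
      comp (comp (dM (unitK (sfStep Lc i) (smStep 3 Lc i) (KInvStep (d := 3) Lc i)) Lc (unitS (sfStep Lc i) (smStep 3 Lc i) (SpureRecAt 3 Lc (toSite r) cE cVH cΛ i)) (unitM (sfStep Lc i) (smStep 3 Lc i) (M1At 3 Lc (toSite r) cΛ i)) κ u) (unitK (sfStep Lc i) (smStep 3 Lc i) (KInvStep (d := 3) Lc i))) (dM (unitK (sfStep Lc i) (smStep 3 Lc i) (KInvStep (d := 3) Lc i)) Lc (unitS (sfStep Lc i) (smStep 3 Lc i) (SpureRecAt 3 Lc (toSite r) cE cVH cΛ i)) (unitM (sfStep Lc i) (smStep 3 Lc i) (M1At 3 Lc (toSite r) cΛ i)) κ' u') yw.1 yw.2 (Sum.inl α) (Sum.inl β)) (e₁ i α β κ u κ'))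
    (hE₂ : ∀ (i : ℕ) (α β κ : Fin (3 + 1)) (u : Site (3 + 1)) (κ' : Fin (3 + 1)), HasSum (fun u' : Site (3 + 1) => ∑' yw : Site (3 + 1) × Site (3 + 1),
      comp (comp (dM (unitK (sfStep Lc i) (smStep 3 Lc i) (KInvStep (d := 3) Lc i)) Lc (unitS (sfStep Lc i) (smStep 3 Lc i) (SpureRecAt 3 Lc (toSite r) cE cVH cΛ i)) (unitM (sfStep Lc i) (smStep 3 Lc i) (M1At 3 Lc (toSite r) cΛ i)) κ' u') (unitK (sfStep Lc i) (smStep 3 Lc i) (KInvStep (d := 3) Lc i))) (dM (unitK (sfStep Lc i) (smStep 3 Lc i) (KInvStep (d := 3) Lc i)) Lc (unitS (sfStep Lc i) (smStep 3 Lc i) (SpureRecAt 3 Lc (toSite r) cE cVH cΛ i)) (unitM (sfStep Lc i) (smStep 3 Lc i) (M1At 3 Lc (toSite r) cΛ i)) κ u) yw.1 yw.2 (Sum.inl α) (Sum.inl β)) (e₂ i α β κ u κ'))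
    (hR₁ : ∀ (i : ℕ) (α β κ : Fin (3 + 1)) (u : Site (3 + 1)) (κ' : Fin (3 + 1)), HasSum (fun u' : Site (3 + 1) => ∑' yw : Site (3 + 1) × Site (3 + 1),
      dM (K2OfK (unitK (sfStep Lc i) (smStep 3 Lc i) (KInvStep (d := 3) Lc i)) Lc (unitS (sfStep Lc i) (smStep 3 Lc i) (SpureRecAt 3 Lc (toSite r) cE cVH cΛ i)) (unitM (sfStep Lc i) (smStep 3 Lc i) (M1At 3 Lc (toSite r) cΛ i)) κ' u') Lc (unitS (sfStep Lc i) (smStep 3 Lc i) (SpureRecAt 3 Lc (toSite r) cE cVH cΛ i)) (unitM (sfStep Lc i) (smStep 3 Lc i) (M1At 3 Lc (toSite r) cΛ i)) κ u yw.1 yw.2 (Sum.inl α) (Sum.inl β)) (r₁ i α β κ u κ'))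
    (hR₂ : ∀ (i : ℕ) (α β κ : Fin (3 + 1)) (u : Site (3 + 1)) (κ' : Fin (3 + 1)), HasSum (fun u' : Site (3 + 1) => ∑' yw : Site (3 + 1) × Site (3 + 1),
      dM (K2OfK (unitK (sfStep Lc i) (smStep 3 Lc i) (KInvStep (d := 3) Lc i)) Lc (unitS (sfStep Lc i) (smStep 3 Lc i) (SpureRecAt 3 Lc (toSite r) cE cVH cΛ i)) (unitM (sfStep Lc i) (smStep 3 Lc i) (M1At 3 Lc (toSite r) cΛ i)) κ u) Lc (unitS (sfStep Lc i) (smStep 3 Lc i) (SpureRecAt 3 Lc (toSite r) cE cVH cΛ i)) (unitM (sfStep Lc i) (smStep 3 Lc i) (M1At 3 Lc (toSite r) cΛ i)) κ' u' yw.1 yw.2 (Sum.inl α) (Sum.inl β)) (r₂ i α β κ u κ'))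
    (hcell : ∀ (i : ℕ) (α β κ κ' : Fin (3 + 1)),
      ∑ ρ' ∈ box (3 + 1) Lc, (e₁ i α β κ (toSite ρ') κ' + e₂ i α β κ (toSite ρ') κ' - (r₁ i α β κ (toSite ρ') κ' + r₂ i α β κ (toSite ρ') κ') / 2)
        + ∑ ρ' ∈ box (3 + 1) Lc, (e₁ i α β κ' (toSite ρ') κ + e₂ i α β κ' (toSite ρ') κ - (r₁ i α β κ' (toSite ρ') κ + r₂ i α β κ' (toSite ρ') κ) / 2) = 0) :
    ∀ i : ℕ,
      (∀ κ u κ' u' t,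
          (cE₂ * (Lc : ℝ) ^ (2 * (3 + 1))) •
              mmRead Lc (K3OfK (unitK (sfStep Lc i) (smStep 3 Lc i) (KInvStep (d := 3) Lc i)) Lc
              (unitS (sfStep Lc i) (smStep 3 Lc i) (SpureRecAt 3 Lc (toSite r) cE cVH cΛ i)) (unitM (sfStep Lc i) (smStep 3 Lc i) (M1At 3 Lc (toSite r) cΛ i))
              (W2SymOfK (unitK (sfStep Lc i) (smStep 3 Lc i) (KInvStep (d := 3) Lc i)) Lc
                (unitS (sfStep Lc i) (smStep 3 Lc i) (SpureRecAt 3 Lc (toSite r) cE cVH cΛ i)) (unitM (sfStep Lc i) (smStep 3 Lc i) (M1At 3 Lc (toSite r) cΛ i)) 0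
                (unitM₂ (sfStep Lc i) (smStep 3 Lc i) (M2Of 3 Lc (mixFFAt (toSite r) Lc) i))) κ (u + (Lc : ℤ) • t) κ' (u' + (Lc : ℤ) • t)) + cB • vh₂S κ (u + (Lc : ℤ) • t) κ' (u' + (Lc : ℤ) • t) =
        shiftK (-((Lc : ℤ) • t)) ((cE₂ * (Lc : ℝ) ^ (2 * (3 + 1))) •
              mmRead Lc (K3OfK (unitK (sfStep Lc i) (smStep 3 Lc i) (KInvStep (d := 3) Lc i)) Lc
              (unitS (sfStep Lc i) (smStep 3 Lc i) (SpureRecAt 3 Lc (toSite r) cE cVH cΛ i)) (unitM (sfStep Lc i) (smStep 3 Lc i) (M1At 3 Lc (toSite r) cΛ i))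
              (W2SymOfK (unitK (sfStep Lc i) (smStep 3 Lc i) (KInvStep (d := 3) Lc i)) Lc
                (unitS (sfStep Lc i) (smStep 3 Lc i) (SpureRecAt 3 Lc (toSite r) cE cVH cΛ i)) (unitM (sfStep Lc i) (smStep 3 Lc i) (M1At 3 Lc (toSite r) cΛ i)) 0
                (unitM₂ (sfStep Lc i) (smStep 3 Lc i) (M2Of 3 Lc (mixFFAt (toSite r) Lc) i))) κ u κ' u') + cB • vh₂S κ u κ' u')) ∧
      (∀ κ κ' κ₁ κ₂,
        zmode Lc (fun κ u κ' u' => (cE₂ * (Lc : ℝ) ^ (2 * (3 + 1))) •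
              mmRead Lc (K3OfK (unitK (sfStep Lc i) (smStep 3 Lc i) (KInvStep (d := 3) Lc i)) Lc
              (unitS (sfStep Lc i) (smStep 3 Lc i) (SpureRecAt 3 Lc (toSite r) cE cVH cΛ i)) (unitM (sfStep Lc i) (smStep 3 Lc i) (M1At 3 Lc (toSite r) cΛ i))
              (W2SymOfK (unitK (sfStep Lc i) (smStep 3 Lc i) (KInvStep (d := 3) Lc i)) Lc
                (unitS (sfStep Lc i) (smStep 3 Lc i) (SpureRecAt 3 Lc (toSite r) cE cVH cΛ i)) (unitM (sfStep Lc i) (smStep 3 Lc i) (M1At 3 Lc (toSite r) cΛ i)) 0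
                (unitM₂ (sfStep Lc i) (smStep 3 Lc i) (M2Of 3 Lc (mixFFAt (toSite r) Lc) i))) κ u κ' u') + cB • vh₂S κ u κ' u') κ κ' (Sum.inl κ₁) (Sum.inl κ₂) +
        zmode Lc (fun κ u κ' u' => (cE₂ * (Lc : ℝ) ^ (2 * (3 + 1))) •
              mmRead Lc (K3OfK (unitK (sfStep Lc i) (smStep 3 Lc i) (KInvStep (d := 3) Lc i)) Lc
              (unitS (sfStep Lc i) (smStep 3 Lc i) (SpureRecAt 3 Lc (toSite r) cE cVH cΛ i)) (unitM (sfStep Lc i) (smStep 3 Lc i) (M1At 3 Lc (toSite r) cΛ i))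
              (W2SymOfK (unitK (sfStep Lc i) (smStep 3 Lc i) (KInvStep (d := 3) Lc i)) Lc
                (unitS (sfStep Lc i) (smStep 3 Lc i) (SpureRecAt 3 Lc (toSite r) cE cVH cΛ i)) (unitM (sfStep Lc i) (smStep 3 Lc i) (M1At 3 Lc (toSite r) cΛ i)) 0
                (unitM₂ (sfStep Lc i) (smStep 3 Lc i) (M2Of 3 Lc (mixFFAt (toSite r) Lc) i))) κ u κ' u') + cB • vh₂S κ u κ' u') κ' κ (Sum.inl κ₁) (Sum.inl κ₂) = 0) := by
  have hLc1 : 1 ≤ Lc := le_trans (by norm_num) hLc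
  intro i
  refine ⟨fun κ u κ' u' t => source_comb_undressed_translate hLc1 hr cE cVH cΛ cE₂ cB Tc hBff hBmm ⟨CB, δB, hδB, hB⟩ hBt i κ u κ' u' t,
    fun κ κ' κ₁ κ₂ => ?_⟩
  exact zmodeSym_comb_bracket_eq_zero_of_cell (d := 3) i hLc1 hr cE cVH cΛ (cE₂ * (Lc : ℝ) ^ (2 * (3 + 1))) cB hBff κ₁ κ₂
    (hE₁ i κ₁ κ₂) (hE₂ i κ₁ κ₂) (hR₁ i κ₁ κ₂) (hR₂ i κ₁ κ₂) κ κ' (hcell i κ₁ κ₂ κ κ')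

/-! ## §2 Rows (U) and (U-drift) of the reference tower, modulo the cell channel identities -/

/-- NOT IN PRINT; OUR PROOF ATTEMPT ([folklore] this lineage's (B) `t2Shape_undressedComb_three_of_F2a` with `hZ := hZ_comb_of_cells`).  **ROW (U) — «T2Shape» OF THE
UNDRESSED-KERNEL COMB-SLOT REFERENCE TOWER MODULO THE CELL CHANNEL IDENTITIES** (`d = 3`, pin `cE = Lc⁴`, `|cE₂| ≤ Lc⁸`). -/
theorem t2Shape_undressedComb_three_of_cells (hLc : 2 ≤ Lc) (hr : r ∈ box (3 + 1) Lc) {cE : ℝ} (hcE : cE = (Lc : ℝ) ^ (3 + 1)) (cVH cΛ cE₂ cB : ℝ)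
    (Tc : Fin 4 → Fin 4 → Fin 4 → Fin 4 → ℝ) {vh₂S : Tab 3}
    (hBff : ∀ κ u κ' u' x z (α β : Fin (3 + 1)), vh₂S κ u κ' u' x z (Sum.inl α) (Sum.inl β) = 0)
    (hBmm : ∀ κ u κ' u' x z (μ ν : Fin (3 + 1)), vh₂S κ u κ' u' x z (Sum.inr μ) (Sum.inr ν) = 0)
    {CB δB : ℝ} (hB : LocStencil₂ vh₂S CB δB) (hδB : 0 < δB)
    (hBt : ∀ (κ : Fin (3 + 1)) (u : Fin (3 + 1) → ℤ) (κ' : Fin (3 + 1)) (u' t : Fin (3 + 1) → ℤ),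
      vh₂S κ (u + (Lc : ℤ) • t) κ' (u' + (Lc : ℤ) • t) = shiftK (-((Lc : ℤ) • t)) (vh₂S κ u κ' u'))
    (hpin : |cE₂| ≤ (Lc : ℝ) ^ (2 * (3 + 1)))
    {e₁ e₂ r₁ r₂ : ℕ → Fin (3 + 1) → Fin (3 + 1) → Fin (3 + 1) → Site (3 + 1) → Fin (3 + 1) → ℝ}
    (hE₁ : ∀ (i : ℕ) (α β κ : Fin (3 + 1)) (u : Site (3 + 1)) (κ' : Fin (3 + 1)), HasSum (fun u' : Site (3 + 1) => ∑' yw : Site (3 + 1) × Site (3 + 1),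
      comp (comp (dM (unitK (sfStep Lc i) (smStep 3 Lc i) (KInvStep (d := 3) Lc i)) Lc (unitS (sfStep Lc i) (smStep 3 Lc i) (SpureRecAt 3 Lc (toSite r) cE cVH cΛ i)) (unitM (sfStep Lc i) (smStep 3 Lc i) (M1At 3 Lc (toSite r) cΛ i)) κ u) (unitK (sfStep Lc i) (smStep 3 Lc i) (KInvStep (d := 3) Lc i))) (dM (unitK (sfStep Lc i) (smStep 3 Lc i) (KInvStep (d := 3) Lc i)) Lc (unitS (sfStep Lc i) (smStep 3 Lc i) (SpureRecAt 3 Lc (toSite r) cE cVH cΛ i)) (unitM (sfStep Lc i) (smStep 3 Lc i) (M1At 3 Lc (toSite r) cΛ i)) κ' u') yw.1 yw.2 (Sum.inl α) (Sum.inl β)) (e₁ i α β κ u κ'))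
    (hE₂ : ∀ (i : ℕ) (α β κ : Fin (3 + 1)) (u : Site (3 + 1)) (κ' : Fin (3 + 1)), HasSum (fun u' : Site (3 + 1) => ∑' yw : Site (3 + 1) × Site (3 + 1),
      comp (comp (dM (unitK (sfStep Lc i) (smStep 3 Lc i) (KInvStep (d := 3) Lc i)) Lc (unitS (sfStep Lc i) (smStep 3 Lc i) (SpureRecAt 3 Lc (toSite r) cE cVH cΛ i)) (unitM (sfStep Lc i) (smStep 3 Lc i) (M1At 3 Lc (toSite r) cΛ i)) κ' u') (unitK (sfStep Lc i) (smStep 3 Lc i) (KInvStep (d := 3) Lc i))) (dM (unitK (sfStep Lc i) (smStep 3 Lc i) (KInvStep (d := 3) Lc i)) Lc (unitS (sfStep Lc i) (smStep 3 Lc i) (SpureRecAt 3 Lc (toSite r) cE cVH cΛ i)) (unitM (sfStep Lc i) (smStep 3 Lc i) (M1At 3 Lc (toSite r) cΛ i)) κ u) yw.1 yw.2 (Sum.inl α) (Sum.inl β)) (e₂ i α β κ u κ'))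
    (hR₁ : ∀ (i : ℕ) (α β κ : Fin (3 + 1)) (u : Site (3 + 1)) (κ' : Fin (3 + 1)), HasSum (fun u' : Site (3 + 1) => ∑' yw : Site (3 + 1) × Site (3 + 1),
      dM (K2OfK (unitK (sfStep Lc i) (smStep 3 Lc i) (KInvStep (d := 3) Lc i)) Lc (unitS (sfStep Lc i) (smStep 3 Lc i) (SpureRecAt 3 Lc (toSite r) cE cVH cΛ i)) (unitM (sfStep Lc i) (smStep 3 Lc i) (M1At 3 Lc (toSite r) cΛ i)) κ' u') Lc (unitS (sfStep Lc i) (smStep 3 Lc i) (SpureRecAt 3 Lc (toSite r) cE cVH cΛ i)) (unitM (sfStep Lc i) (smStep 3 Lc i) (M1At 3 Lc (toSite r) cΛ i)) κ u yw.1 yw.2 (Sum.inl α) (Sum.inl β)) (r₁ i α β κ u κ'))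
    (hR₂ : ∀ (i : ℕ) (α β κ : Fin (3 + 1)) (u : Site (3 + 1)) (κ' : Fin (3 + 1)), HasSum (fun u' : Site (3 + 1) => ∑' yw : Site (3 + 1) × Site (3 + 1),
      dM (K2OfK (unitK (sfStep Lc i) (smStep 3 Lc i) (KInvStep (d := 3) Lc i)) Lc (unitS (sfStep Lc i) (smStep 3 Lc i) (SpureRecAt 3 Lc (toSite r) cE cVH cΛ i)) (unitM (sfStep Lc i) (smStep 3 Lc i) (M1At 3 Lc (toSite r) cΛ i)) κ u) Lc (unitS (sfStep Lc i) (smStep 3 Lc i) (SpureRecAt 3 Lc (toSite r) cE cVH cΛ i)) (unitM (sfStep Lc i) (smStep 3 Lc i) (M1At 3 Lc (toSite r) cΛ i)) κ' u' yw.1 yw.2 (Sum.inl α) (Sum.inl β)) (r₂ i α β κ u κ'))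
    (hcell : ∀ (i : ℕ) (α β κ κ' : Fin (3 + 1)),
      ∑ ρ' ∈ box (3 + 1) Lc, (e₁ i α β κ (toSite ρ') κ' + e₂ i α β κ (toSite ρ') κ' - (r₁ i α β κ (toSite ρ') κ' + r₂ i α β κ (toSite ρ') κ') / 2)
        + ∑ ρ' ∈ box (3 + 1) Lc, (e₁ i α β κ' (toSite ρ') κ + e₂ i α β κ' (toSite ρ') κ - (r₁ i α β κ' (toSite ρ') κ + r₂ i α β κ' (toSite ρ') κ) / 2) = 0) :
    ∃ C₂ δ₂ : ℝ, 0 < δ₂ ∧ ∀ j, LocStencil₂ (unitS₂ (sfStep Lc j) (smStep 3 Lc j) (T2RecOf 3 Lc (fun j => KInvStep (d := 3) Lc j) (SpureRecAt 3 Lc (toSite r) cE cVH cΛ) (M1At 3 Lc (toSite r) cΛ) cE₂ cB Tc vh₂S (mixFFAt (toSite r) Lc) j)) C₂ δ₂ := by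
  have hZ := hZ_comb_of_cells hLc hr cE cVH cΛ cE₂ cB Tc hBff hBmm hB hδB hBt hE₁ hE₂ hR₁ hR₂ hcell
  exact t2Shape_undressedComb_three_of_F2a hLc hr hcE cVH cΛ cE₂ cB Tc hBff hBmm hB hδB hpin hZ

/-- NOT IN PRINT; OUR PROOF ATTEMPT ([folklore] this lineage's PART 3 `exists_hU_three_of_F2a_pinEq` with `hZ := hZ_comb_of_cells`).  **ROW (U-drift) — THE OWNER's `hU`
QUINTUPLE FOR THE REFERENCE TOWER MODULO THE CELL CHANNEL IDENTITIES** (`d = 3`, pin `cE = Lc⁴`, EXACT pin `cE₂ = Lc⁸`). -/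
theorem exists_hU_three_of_cells_pinEq (hLc : 2 ≤ Lc) (hr : r ∈ box (3 + 1) Lc) {cE : ℝ} (hcE : cE = (Lc : ℝ) ^ (3 + 1)) (cVH cΛ cE₂ cB : ℝ)
    (Tc : Fin 4 → Fin 4 → Fin 4 → Fin 4 → ℝ) {vh₂S : Tab 3}
    (hBff : ∀ κ u κ' u' x z (α β : Fin (3 + 1)), vh₂S κ u κ' u' x z (Sum.inl α) (Sum.inl β) = 0)
    (hBmm : ∀ κ u κ' u' x z (μ ν : Fin (3 + 1)), vh₂S κ u κ' u' x z (Sum.inr μ) (Sum.inr ν) = 0)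
    {CB δB : ℝ} (hB : LocStencil₂ vh₂S CB δB) (hδB : 0 < δB)
    (hBt : ∀ (κ : Fin (3 + 1)) (u : Fin (3 + 1) → ℤ) (κ' : Fin (3 + 1)) (u' t : Fin (3 + 1) → ℤ),
      vh₂S κ (u + (Lc : ℤ) • t) κ' (u' + (Lc : ℤ) • t) = shiftK (-((Lc : ℤ) • t)) (vh₂S κ u κ' u'))
    (hpinEq : cE₂ = (Lc : ℝ) ^ (2 * (3 + 1)))
    {e₁ e₂ r₁ r₂ : ℕ → Fin (3 + 1) → Fin (3 + 1) → Fin (3 + 1) → Site (3 + 1) → Fin (3 + 1) → ℝ}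
    (hE₁ : ∀ (i : ℕ) (α β κ : Fin (3 + 1)) (u : Site (3 + 1)) (κ' : Fin (3 + 1)), HasSum (fun u' : Site (3 + 1) => ∑' yw : Site (3 + 1) × Site (3 + 1),
      comp (comp (dM (unitK (sfStep Lc i) (smStep 3 Lc i) (KInvStep (d := 3) Lc i)) Lc (unitS (sfStep Lc i) (smStep 3 Lc i) (SpureRecAt 3 Lc (toSite r) cE cVH cΛ i)) (unitM (sfStep Lc i) (smStep 3 Lc i) (M1At 3 Lc (toSite r) cΛ i)) κ u) (unitK (sfStep Lc i) (smStep 3 Lc i) (KInvStep (d := 3) Lc i))) (dM (unitK (sfStep Lc i) (smStep 3 Lc i) (KInvStep (d := 3) Lc i)) Lc (unitS (sfStep Lc i) (smStep 3 Lc i) (SpureRecAt 3 Lc (toSite r) cE cVH cΛ i)) (unitM (sfStep Lc i) (smStep 3 Lc i) (M1At 3 Lc (toSite r) cΛ i)) κ' u') yw.1 yw.2 (Sum.inl α) (Sum.inl β)) (e₁ i α β κ u κ'))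
    (hE₂ : ∀ (i : ℕ) (α β κ : Fin (3 + 1)) (u : Site (3 + 1)) (κ' : Fin (3 + 1)), HasSum (fun u' : Site (3 + 1) => ∑' yw : Site (3 + 1) × Site (3 + 1),
      comp (comp (dM (unitK (sfStep Lc i) (smStep 3 Lc i) (KInvStep (d := 3) Lc i)) Lc (unitS (sfStep Lc i) (smStep 3 Lc i) (SpureRecAt 3 Lc (toSite r) cE cVH cΛ i)) (unitM (sfStep Lc i) (smStep 3 Lc i) (M1At 3 Lc (toSite r) cΛ i)) κ' u') (unitK (sfStep Lc i) (smStep 3 Lc i) (KInvStep (d := 3) Lc i))) (dM (unitK (sfStep Lc i) (smStep 3 Lc i) (KInvStep (d := 3) Lc i)) Lc (unitS (sfStep Lc i) (smStep 3 Lc i) (SpureRecAt 3 Lc (toSite r) cE cVH cΛ i)) (unitM (sfStep Lc i) (smStep 3 Lc i) (M1At 3 Lc (toSite r) cΛ i)) κ u) yw.1 yw.2 (Sum.inl α) (Sum.inl β)) (e₂ i α β κ u κ'))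
    (hR₁ : ∀ (i : ℕ) (α β κ : Fin (3 + 1)) (u : Site (3 + 1)) (κ' : Fin (3 + 1)), HasSum (fun u' : Site (3 + 1) => ∑' yw : Site (3 + 1) × Site (3 + 1),
      dM (K2OfK (unitK (sfStep Lc i) (smStep 3 Lc i) (KInvStep (d := 3) Lc i)) Lc (unitS (sfStep Lc i) (smStep 3 Lc i) (SpureRecAt 3 Lc (toSite r) cE cVH cΛ i)) (unitM (sfStep Lc i) (smStep 3 Lc i) (M1At 3 Lc (toSite r) cΛ i)) κ' u') Lc (unitS (sfStep Lc i) (smStep 3 Lc i) (SpureRecAt 3 Lc (toSite r) cE cVH cΛ i)) (unitM (sfStep Lc i) (smStep 3 Lc i) (M1At 3 Lc (toSite r) cΛ i)) κ u yw.1 yw.2 (Sum.inl α) (Sum.inl β)) (r₁ i α β κ u κ'))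
    (hR₂ : ∀ (i : ℕ) (α β κ : Fin (3 + 1)) (u : Site (3 + 1)) (κ' : Fin (3 + 1)), HasSum (fun u' : Site (3 + 1) => ∑' yw : Site (3 + 1) × Site (3 + 1),
      dM (K2OfK (unitK (sfStep Lc i) (smStep 3 Lc i) (KInvStep (d := 3) Lc i)) Lc (unitS (sfStep Lc i) (smStep 3 Lc i) (SpureRecAt 3 Lc (toSite r) cE cVH cΛ i)) (unitM (sfStep Lc i) (smStep 3 Lc i) (M1At 3 Lc (toSite r) cΛ i)) κ u) Lc (unitS (sfStep Lc i) (smStep 3 Lc i) (SpureRecAt 3 Lc (toSite r) cE cVH cΛ i)) (unitM (sfStep Lc i) (smStep 3 Lc i) (M1At 3 Lc (toSite r) cΛ i)) κ' u' yw.1 yw.2 (Sum.inl α) (Sum.inl β)) (r₂ i α β κ u κ'))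
    (hcell : ∀ (i : ℕ) (α β κ κ' : Fin (3 + 1)),
      ∑ ρ' ∈ box (3 + 1) Lc, (e₁ i α β κ (toSite ρ') κ' + e₂ i α β κ (toSite ρ') κ' - (r₁ i α β κ (toSite ρ') κ' + r₂ i α β κ (toSite ρ') κ') / 2)
        + ∑ ρ' ∈ box (3 + 1) Lc, (e₁ i α β κ' (toSite ρ') κ + e₂ i α β κ' (toSite ρ') κ - (r₁ i α β κ' (toSite ρ') κ + r₂ i α β κ' (toSite ρ') κ) / 2) = 0) :
    ∃ cU ϑU δU : ℝ, 0 ≤ cU ∧ 0 ≤ ϑU ∧ ϑU < 1 ∧ 0 < δU ∧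
      ∀ n : ℕ, LocStencil₂ ((fun n : ℕ => unitS₂ (sfStep Lc n) (smStep 3 Lc n) (T2RecOf 3 Lc (fun j => KInvStep (d := 3) Lc j) (SpureRecAt 3 Lc (toSite r) cE cVH cΛ) (M1At 3 Lc (toSite r) cΛ) cE₂ cB Tc vh₂S (mixFFAt (toSite r) Lc) n))
          (n + 1) - (fun n : ℕ => unitS₂ (sfStep Lc n) (smStep 3 Lc n) (T2RecOf 3 Lc (fun j => KInvStep (d := 3) Lc j) (SpureRecAt 3 Lc (toSite r) cE cVH cΛ) (M1At 3 Lc (toSite r) cΛ) cE₂ cB Tc vh₂S (mixFFAt (toSite r) Lc) n)) n) (cU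
          * ϑU ^ n) δU := by
  have hZ := hZ_comb_of_cells hLc hr cE cVH cΛ cE₂ cB Tc hBff hBmm hB hδB hBt hE₁ hE₂ hR₁ hR₂ hcell
  exact exists_hU_three_of_F2a_pinEq hLc hr hcE cVH cΛ cE₂ cB Tc hBff hBmm hB hδB hBt hpinEq hZ

end Summit.QuantumFields.BalabanUV.Beta.GAN24.SourceBracketChannelChargeComb

end
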